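import Literature.MathematicalPhysics.QuantumLattice.KomaPiFluxCoulombKLSInequality
import Literature.MathematicalPhysics.QuantumLattice.KomaPiFluxVariationalEnergy
import HarnessLib

/-!
# Koma's Appendix B with the Coulomb repulsion: the lower bound on the nearest-neighbour
# `η` correlation (Koma 2022, (6.36), App. B, §8)

T. Koma, *Nambu–Goldstone modes for superconducting lattice fermions*, arXiv:2201.13135 (2022)
[Koma2022].  Appendix B bounds the nearest-neighbour correlation `E₁` from below by comparing the
thermal energy with a variational ground-state energy ((B.1)–(B.18)); §8 adds the Coulomb term
`H_repul = g'Σ_{bonds}Γ³_xΓ³_y` ((8.1), (8.3)).  Since `-1 ≤ Γ³_xΓ³_y ≤ 1` on every bond, the Coulomb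
term moves both sides of the comparison by at most `g'(d+1)|Λ|`, so (6.36) survives with an extra
`-2g'/g`:

* `PairHopRP.two_smul_one_sub_gammaThree_mul_posSemidef` — `2(1 - Γ³_xΓ³_y) ≥ 0` as an operator;
* `KomaPiFlux.re_gibbsState_coulomb_ge` — `Re⟨H_repul⟩_β ≥ -g'(d+1)|Λ|` in any Gibbs state, and
  `KomaPiFlux.groundEnergy_hamiltonianC_le` — `E₀(H + H_repul) ≤ E₀(H) + g'(d+1)|Λ|`;
* `KomaPiFlux.re_gibbsState_hamiltonianC_eq` — (B.1) for `H_C = H(κ,U;g,g',0;0)` in its own Gibbs state;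
* `KomaPiFlux.nearestNeighbour_lower_bound_coulomb`, `KomaPiFlux.nearestNeighbour_ge_coulomb` —
  (B.3)+(B.11) and (6.36) with the Coulomb term:
  `g N₁ ≥ g(d+1)|Λ|/2 - {U + 2g(d+1)}₊|Λ|/2 - 4(d+1)κ|Λ| - 2g'(d+1)|Λ| - |Λ| log 4/β`.

All statements are PROVED; no named fact.

## References

* [Koma2022] T. Koma, arXiv:2201.13135, (6.36), App. B (B.1)–(B.18), §8 (8.1)–(8.4).
* [Ruelle1969] D. Ruelle, *Statistical Mechanics: Rigorous Results*, Benjamin 1969, §2.5.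
-/

noncomputable section

namespace Literature.MathematicalPhysics.QuantumLattice

open Matrix Finset HubbardWave0
open scoped ComplexOrder

namespace PairHopRP

variable {Λ : Type*} [LinearOrder Λ] [Fintype Λ]

/-- **`2(1 - Γ³_xΓ³_y) = (Γ³_x - Γ³_y)² + (1 - (Γ³_x)²) + (1 - (Γ³_y)²) ≥ 0`**: the Coulomb bond operator
is at most `1`. [cite: Koma2022, (3.9), (8.1)] -/
theorem two_smul_one_sub_gammaThree_mul_posSemidef (x y : Λ) :
    ((2 : ℂ) • ((1 : Matrix (Finset (Orb Λ)) (Finset (Orb Λ)) ℂ) - gammaThree x * gammaThree y)).PosSemidef := by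
  have hn : ∀ (z : Λ) (σ : Fin 2), (numberOp z σ)ᴴ = numberOp z σ := fun z σ => by
    rw [numberOp]; exact (numberAt_isHermitian (orb z σ)).eq
  have hsq : ∀ z : Λ, ((1 : Matrix (Finset (Orb Λ)) (Finset (Orb Λ)) ℂ) - gammaThree z * gammaThree z).PosSemidef :=
    fun z => by
      rw [one_sub_gammaThree_sq]
      have h : (numberOp z 0 - numberOp z 1)ᴴ = numberOp z 0 - numberOp z 1 := by rw [conjTranspose_sub, hn, hn]
      nth_rw 1 [← h]
      exact Matrix.posSemidef_conjTranspose_mul_self _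
  have hA : ((gammaThree x - gammaThree y)ᴴ * (gammaThree x - gammaThree y)).PosSemidef :=
    Matrix.posSemidef_conjTranspose_mul_self _
  have e : (2 : ℂ) • ((1 : Matrix (Finset (Orb Λ)) (Finset (Orb Λ)) ℂ) - gammaThree x * gammaThree y) =
      (gammaThree x - gammaThree y)ᴴ * (gammaThree x - gammaThree y) + (1 - gammaThree x * gammaThree x) +
        (1 - gammaThree y * gammaThree y) := by
    rw [conjTranspose_sub, (gammaThree_isHermitian x).eq, (gammaThree_isHermitian y).eq, Matrix.sub_mul,
      Matrix.mul_sub, Matrix.mul_sub, (gammaThree_commute y x).eq, two_smul]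
    abel
  rw [e]
  exact (hA.add (hsq x)).add (hsq y)

/-- In the tracial ground state of any Hermitian `A`, `Re ω_A(Γ³_xΓ³_y) ≤ 1`. [cite: Koma2022, (8.1)]
[cite: BratteliRobinson1997, §5.3.1] -/
theorem re_groundStateFunctional_gammaThree_mul_le_one {A : Matrix (Finset (Orb Λ)) (Finset (Orb Λ)) ℂ}
    (hA : A.IsHermitian) (x y : Λ) : (A.groundStateFunctional (gammaThree x * gammaThree y)).re ≤ 1 := by
  have h := groundStateFunctional_nonneg_of_posSemidef A (two_smul_one_sub_gammaThree_mul_posSemidef x y)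
  rw [map_smul, map_sub, groundStateFunctional_one hA, smul_eq_mul, show (2 : ℂ) = ((2 : ℝ) : ℂ) by norm_num]
    at h
  obtain ⟨hre, -⟩ := Complex.nonneg_iff.mp h
  rw [Complex.re_ofReal_mul, Complex.sub_re, Complex.one_re] at hre
  linarith

end PairHopRP

open PairHopRP FermionTorus LiebCutRP
open Literature.Probability.LatticeModels

namespace KomaPiFlux

attribute [local instance] LiebCutRP.decEqTorus

variable {d L : ℕ} [NeZero L]

/-! ### The Coulomb term moves energies by at most `g'(d+1)|Λ|` -/

/-- **`Re⟨H_repul⟩_β ≥ -g'(d+1)|Λ|`** in the Gibbs state of any Hermitian `H'` (`g' ≥ 0`, `L ≥ 3`).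
[cite: Koma2022, (8.1), §8] -/
theorem re_gibbsState_coulomb_ge (h3 : 3 ≤ L) {g' : ℝ} (hg' : 0 ≤ g') (β : ℝ)
    {H' : Matrix (Finset (Orb (FermionTorus (d + 1) L))) (Finset (Orb (FermionTorus (d + 1) L))) ℂ} (hH' : H'.IsHermitian) :
    -(g' * (d + 1) * (L : ℝ) ^ (d + 1)) ≤ (gibbsState β H' (coulomb (G d L) g')).re := by
  have hcount := sum_adj_indicator_eq (d := d) h3
  unfold coulomb
  rw [map_sum, Complex.re_sum]
  simp_rw [map_sum, Complex.re_sum]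
  have hterm : ∀ x y : FermionTorus (d + 1) L,
      (if (G d L).Adj x y then (1 : ℝ) else 0) * (-(g' / 2)) ≤
        (gibbsState β H' (if (G d L).Adj x y then coulombBond g' x y else 0)).re := by
    intro x y
    split_ifs
    · rw [coulombBond, map_smul, smul_eq_mul, Complex.re_ofReal_mul, one_mul]
      have h := neg_one_le_re_gibbsState_gammaThree_mul β hH' x y
      nlinarith
    · rw [map_zero, Complex.zero_re, zero_mul]
  calc -(g' * (d + 1) * (L : ℝ) ^ (d + 1))
      = (∑ x : FermionTorus (d + 1) L, ∑ y : FermionTorus (d + 1) L, (if (G d L).Adj x y then (1 : ℝ) else 0)) *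
          (-(g' / 2)) := by rw [hcount]; ring
    _ = ∑ x : FermionTorus (d + 1) L, ∑ y : FermionTorus (d + 1) L,
          (if (G d L).Adj x y then (1 : ℝ) else 0) * (-(g' / 2)) := by
        rw [Finset.sum_mul]
        refine Finset.sum_congr rfl fun x _ => ?_
        rw [Finset.sum_mul]
    _ ≤ ∑ x : FermionTorus (d + 1) L, ∑ y : FermionTorus (d + 1) L,
          (gibbsState β H' (if (G d L).Adj x y then coulombBond g' x y else 0)).re :=
        Finset.sum_le_sum fun x _ => Finset.sum_le_sum fun y _ => hterm x y

/-- **`Re ω_{H'}(H_repul) ≤ g'(d+1)|Λ|`** in the tracial ground state of any Hermitian `H'`.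
[cite: Koma2022, (8.1), §8] -/
theorem re_groundStateFunctional_coulomb_le (h3 : 3 ≤ L) {g' : ℝ} (hg' : 0 ≤ g')
    {H' : Matrix (Finset (Orb (FermionTorus (d + 1) L))) (Finset (Orb (FermionTorus (d + 1) L))) ℂ} (hH' : H'.IsHermitian) :
    (H'.groundStateFunctional (coulomb (G d L) g')).re ≤ g' * (d + 1) * (L : ℝ) ^ (d + 1) := by
  have hcount := sum_adj_indicator_eq (d := d) h3
  unfold coulomb
  rw [map_sum, Complex.re_sum]
  simp_rw [map_sum, Complex.re_sum]
  have hterm : ∀ x y : FermionTorus (d + 1) L,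
      (H'.groundStateFunctional (if (G d L).Adj x y then coulombBond g' x y else 0)).re ≤
        (if (G d L).Adj x y then (1 : ℝ) else 0) * (g' / 2) := by
    intro x y
    split_ifs
    · rw [coulombBond, map_smul, smul_eq_mul, Complex.re_ofReal_mul, one_mul]
      exact (mul_le_mul_of_nonneg_left (re_groundStateFunctional_gammaThree_mul_le_one hH' x y)
        (by positivity : (0 : ℝ) ≤ g' / 2)).trans_eq (mul_one _)
    · rw [map_zero, Complex.zero_re, zero_mul]
  calc ∑ x : FermionTorus (d + 1) L, ∑ y : FermionTorus (d + 1) L,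
        (H'.groundStateFunctional (if (G d L).Adj x y then coulombBond g' x y else 0)).re
      ≤ ∑ x : FermionTorus (d + 1) L, ∑ y : FermionTorus (d + 1) L,
          (if (G d L).Adj x y then (1 : ℝ) else 0) * (g' / 2) :=
        Finset.sum_le_sum fun x _ => Finset.sum_le_sum fun y _ => hterm x y
    _ = (∑ x : FermionTorus (d + 1) L, ∑ y : FermionTorus (d + 1) L, (if (G d L).Adj x y then (1 : ℝ) else 0)) *
          (g' / 2) := by
        rw [Finset.sum_mul]
        refine Finset.sum_congr rfl fun x _ => ?_
        rw [Finset.sum_mul]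
    _ = g' * (d + 1) * (L : ℝ) ^ (d + 1) := by rw [hcount]; ring

/-- **`E₀(H(κ,U;g,g',h;B)) ≤ E₀(H(κ,U;g,h;B)) + g'(d+1)|Λ|`** (`g' ≥ 0`): the Coulomb term raises the
ground-state energy by at most `g'` per bond (variational principle in the ground state of `H`).
[cite: Koma2022, App. B (B.17), §8 (8.1)] -/
theorem groundEnergy_hamiltonianC_le (h3 : 3 ≤ L) (κ U g : ℝ) {g' : ℝ} (hg' : 0 ≤ g')
    (h : FermionTorus (d + 1) L → FermionTorus (d + 1) L → ℝ) (B : ℝ) :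
    (hamiltonianC κ U g g' h B).groundEnergy ≤ (hamiltonian κ U g h B).groundEnergy + g' * (d + 1) * (L : ℝ) ^ (d + 1) := by
  have hH : (hamiltonian κ U g h B).IsHermitian := hamiltonian_isHermitian (G d L) (piFluxAmpl κ) (piFluxAmpl_herm κ) U g h B
  have hHC : (hamiltonianC κ U g g' h B).IsHermitian := hamiltonianC_isHermitian κ U g g' h B
  have h1 := groundEnergy_le_groundStateFunctional_re hH hHC
  have hsplit : (hamiltonian κ U g h B).groundStateFunctional (hamiltonianC κ U g g' h B) =
      (hamiltonian κ U g h B).groundStateFunctional (hamiltonian κ U g h B) +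
        (hamiltonian κ U g h B).groundStateFunctional (coulomb (G d L) g') := by
    rw [hamiltonianC_eq, map_add]
  rw [hsplit, Complex.add_re, groundStateFunctional_hamiltonian hH, Complex.ofReal_re] at h1
  have h2 := re_groundStateFunctional_coulomb_le (d := d) h3 hg' hH
  linarith

/-! ### (B.1) with the Coulomb term -/

/-- **(B.1) with the Coulomb term, finite volume**: for `H_C = H(κ,U;g,g',0;0)` and its own Gibbs state,
`Re⟨H_C⟩ = Re⟨K(T_π)⟩ + (U/2 + g(d+1)) Σ_x Re⟨P_x⟩ - U|Λ|/4 - g N₁ + Re⟨H_repul⟩`, with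
`N₁ = Σ_i Σ_x Re⟨Γ¹_xΓ¹_{x+e_i}⟩` (the `Γ²Γ²` correlations equal the `Γ¹Γ¹` ones by the rotation
symmetry, which the Coulomb term respects). [cite: Koma2022, App. B (B.1), §8] -/
theorem re_gibbsState_hamiltonianC_eq (h3 : 3 ≤ L) (β κ U g g' : ℝ) :
    (gibbsState β (hamiltonianC κ U g g' (fun (_ _ : FermionTorus (d + 1) L) => (0 : ℝ)) 0)
        (hamiltonianC κ U g g' (fun (_ _ : FermionTorus (d + 1) L) => (0 : ℝ)) 0)).re =
      (gibbsState β (hamiltonianC κ U g g' (fun (_ _ : FermionTorus (d + 1) L) => (0 : ℝ)) 0)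
          (peierlsHubbard (G d L) (piFluxAmpl κ) 0)).re +
        (U / 2 + g * (d + 1)) * ∑ x : FermionTorus (d + 1) L,
          (gibbsState β (hamiltonianC κ U g g' (fun (_ _ : FermionTorus (d + 1) L) => (0 : ℝ)) 0)
            (gammaOne x * gammaOne x)).re -
        U * (L : ℝ) ^ (d + 1) / 4 -
        g * ∑ i : Fin (d + 1), ∑ x : FermionTorus (d + 1) L,
          pairCorr β (hamiltonianC κ U g g' (fun (_ _ : FermionTorus (d + 1) L) => (0 : ℝ)) 0) x (shift x i) +
        (gibbsState β (hamiltonianC κ U g g' (fun (_ _ : FermionTorus (d + 1) L) => (0 : ℝ)) 0)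
          (coulomb (G d L) g')).re := by
  set H₀ := hamiltonianC κ U g g' (fun (_ _ : FermionTorus (d + 1) L) => (0 : ℝ)) 0 with hH₀
  have hH : H₀.IsHermitian := hamiltonianC_isHermitian κ U g g' _ 0
  have hZ : partitionFn β H₀ ≠ 0 := (partitionFn_pos β hH).ne'
  -- the `Γ¹Γ¹` and `Γ²Γ²` nearest-neighbour sums
  have h11 : ∑ x : FermionTorus (d + 1) L, ∑ y : FermionTorus (d + 1) L,
      (if (G d L).Adj x y then (gibbsState β H₀ (gammaOne x * gammaOne y)).re else 0) =
      2 * ∑ i : Fin (d + 1), ∑ x : FermionTorus (d + 1) L, pairCorr β H₀ x (shift x i) := by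
    have hsymm : ∀ x y : FermionTorus (d + 1) L, pairCorr β H₀ y x = pairCorr β H₀ x y := fun x y => pairCorr_symm β H₀ y x
    rw [← sum_shift_add_sum_shift_swap h3 (fun x y => (gibbsState β H₀ (gammaOne x * gammaOne y)).re)]
    change ∑ x, ∑ μ, (pairCorr β H₀ x (shift x μ) + pairCorr β H₀ (shift x μ) x) = _
    simp_rw [hsymm, ← two_mul]
    rw [Finset.sum_comm, Finset.mul_sum]
    refine Finset.sum_congr rfl fun i _ => ?_
    rw [Finset.mul_sum]
  have h22 := sum_adj_re_gibbsState_gammaTwo_mul_coulomb (d := d) h3 β κ U g g'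
  rw [← hH₀] at h22
  -- expand the observable `H_C = H₀' + H_repul` with `H₀'` in `η`-spin form
  have hobs : gibbsState β H₀ H₀ = gibbsState β H₀ (peierlsHubbard (G d L) (piFluxAmpl κ) 0 +
      ((U / 2 + g * (d + 1) : ℝ) : ℂ) • ∑ x : FermionTorus (d + 1) L, gammaOne x * gammaOne x -
      ((U * (L : ℝ) ^ (d + 1) / 4 : ℝ) : ℂ) • (1 : Matrix _ _ ℂ) -
      ((g / 4 : ℝ) : ℂ) • ∑ x : FermionTorus (d + 1) L, ∑ y : FermionTorus (d + 1) L,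
        (if (G d L).Adj x y then gammaOne x * gammaOne y + gammaTwo x * gammaTwo y else 0)) +
      gibbsState β H₀ (coulomb (G d L) g') := by
    rw [← map_add]
    congr 1
    rw [hH₀, hamiltonianC_eq, hamiltonian_zero_expand h3 κ U g]
  -- the two expectation sums
  have hP : (gibbsState β H₀ (∑ x : FermionTorus (d + 1) L, gammaOne x * gammaOne x)).re =
      ∑ x : FermionTorus (d + 1) L, (gibbsState β H₀ (gammaOne x * gammaOne x)).re := by
    rw [map_sum, Complex.re_sum]
  have hpair : (gibbsState β H₀ (∑ x : FermionTorus (d + 1) L, ∑ y : FermionTorus (d + 1) L,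
      (if (G d L).Adj x y then gammaOne x * gammaOne y + gammaTwo x * gammaTwo y else 0))).re =
      4 * ∑ i : Fin (d + 1), ∑ x : FermionTorus (d + 1) L, pairCorr β H₀ x (shift x i) := by
    have h : ∀ x : FermionTorus (d + 1) L, (gibbsState β H₀ (∑ y : FermionTorus (d + 1) L,
        (if (G d L).Adj x y then gammaOne x * gammaOne y + gammaTwo x * gammaTwo y else 0))).re =
        ∑ y : FermionTorus (d + 1) L, ((if (G d L).Adj x y then (gibbsState β H₀ (gammaOne x * gammaOne y)).re else 0) +
          (if (G d L).Adj x y then (gibbsState β H₀ (gammaTwo x * gammaTwo y)).re else 0)) := by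
      intro x
      rw [map_sum, Complex.re_sum]
      refine Finset.sum_congr rfl fun y _ => ?_
      split_ifs
      · rw [map_add, Complex.add_re]
      · rw [map_zero, Complex.zero_re, add_zero]
    rw [map_sum, Complex.re_sum]
    simp_rw [h, Finset.sum_add_distrib]
    rw [h11, h22]
    ring
  rw [hobs, Complex.add_re, map_sub, map_sub, map_add, map_smul, map_smul, map_smul, smul_eq_mul, smul_eq_mul,
    smul_eq_mul, gibbsState_one β H₀ hZ, mul_one, Complex.sub_re, Complex.sub_re, Complex.add_re, Complex.re_ofReal_mul,
    Complex.re_ofReal_mul, Complex.ofReal_re, hP, hpair]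
  ring

/-! ### (B.3) + (B.11) and (6.36) with the Coulomb term -/

/-- **(B.3)+(B.11) with the Coulomb term, finite volume**: for `H_C = H(κ,U;g,g',0;0)` (`κ, g' ≥ 0`,
`β > 0`, `L ≥ 3`),
`g N₁ ≥ -E₀(H_C) - |Λ| log 4/β - 4(d+1)κ|Λ| - U|Λ|/4 - {-(U/2 + g(d+1))}₊|Λ| - g'(d+1)|Λ|`.
[cite: Koma2022, (6.36), App. B (B.3), (B.11), §8] -/
theorem nearestNeighbour_lower_bound_coulomb (h3 : 3 ≤ L) {β : ℝ} (hβ : 0 < β) {κ : ℝ} (hκ : 0 ≤ κ) (U g : ℝ)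
    {g' : ℝ} (hg' : 0 ≤ g') :
    -(hamiltonianC κ U g g' (fun (_ _ : FermionTorus (d + 1) L) => (0 : ℝ)) 0).groundEnergy -
        (L : ℝ) ^ (d + 1) * Real.log 4 / β - 4 * (d + 1) * κ * (L : ℝ) ^ (d + 1) - U * (L : ℝ) ^ (d + 1) / 4 -
        max (-(U / 2 + g * (d + 1))) 0 * (L : ℝ) ^ (d + 1) - g' * (d + 1) * (L : ℝ) ^ (d + 1) ≤
      g * ∑ i : Fin (d + 1), ∑ x : FermionTorus (d + 1) L,
        pairCorr β (hamiltonianC κ U g g' (fun (_ _ : FermionTorus (d + 1) L) => (0 : ℝ)) 0) x (shift x i) := by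
  set H₀ := hamiltonianC κ U g g' (fun (_ _ : FermionTorus (d + 1) L) => (0 : ℝ)) 0 with hH₀
  have hH : H₀.IsHermitian := hamiltonianC_isHermitian κ U g g' _ 0
  have hE := re_gibbsState_hamiltonianC_eq (d := d) h3 β κ U g g'
  rw [← hH₀] at hE
  have hK := re_gibbsState_hopping_ge (d := d) h3 hκ β hH
  have hT := re_gibbsState_self_le_groundEnergy_add (d := d) hβ hH
  have hC := re_gibbsState_coulomb_ge (d := d) h3 hg' β hH
  -- `0 ≤ Σ Re⟨P_x⟩ ≤ |Λ|`
  have hP0 : 0 ≤ ∑ x : FermionTorus (d + 1) L, (gibbsState β H₀ (gammaOne x * gammaOne x)).re :=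
    Finset.sum_nonneg fun x _ => by
      rw [gammaOne_sq_eq_gammaTwo_sq]
      have hA : (gammaTwo x * gammaTwo x).PosSemidef := by
        nth_rw 1 [← (gammaTwo_isHermitian x).eq]
        exact Matrix.posSemidef_conjTranspose_mul_self _
      exact (Complex.nonneg_iff.mp (gibbsState_nonneg_of_posSemidef β hH hA)).1
  have hP1 : ∑ x : FermionTorus (d + 1) L, (gibbsState β H₀ (gammaOne x * gammaOne x)).re ≤ (L : ℝ) ^ (d + 1) := by
    calc ∑ x : FermionTorus (d + 1) L, (gibbsState β H₀ (gammaOne x * gammaOne x)).re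
        ≤ ∑ _x : FermionTorus (d + 1) L, (1 : ℝ) := Finset.sum_le_sum fun x _ => by
          rw [gammaOne_sq_eq_gammaTwo_sq]; exact re_gibbsState_gammaTwo_sq_le_one β hH x
      _ = (L : ℝ) ^ (d + 1) := by
          rw [Finset.sum_const, Finset.card_univ, nsmul_eq_mul, mul_one,
            show Fintype.card (FermionTorus (d + 1) L) = L ^ (d + 1) by
              simp only [FermionTorus, Fintype.card_lex, Fintype.card_fun, Fintype.card_fin], Nat.cast_pow]
  -- `(U/2 + gD) Σ⟨P⟩ ≥ -{-(U/2+gD)}₊ |Λ|`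
  have hcoef : -(max (-(U / 2 + g * (d + 1))) 0 * (L : ℝ) ^ (d + 1)) ≤
      (U / 2 + g * (d + 1)) * ∑ x : FermionTorus (d + 1) L, (gibbsState β H₀ (gammaOne x * gammaOne x)).re := by
    rcases le_or_gt 0 (U / 2 + g * (d + 1)) with hc | hc
    · rw [max_eq_right (by linarith), zero_mul, neg_zero]
      exact mul_nonneg hc hP0
    · rw [max_eq_left (by linarith)]
      nlinarith
  linarith

/-- **Koma's (6.36) with the Coulomb term, finite volume** (Lieb frame; even `L ≥ 4`, `β > 0`, `κ ≥ 0`,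
`g ≥ 0`, `g' ≥ 0`): with `N₁ = Σ_iΣ_x Re⟨Γ¹_xΓ¹_{x+e_i}⟩_β` in the Gibbs state of `H_C = H(κ,U;g,g',0;0)`,
`g N₁ ≥ g(d+1)|Λ|/2 - {U + 2g(d+1)}₊|Λ|/2 - 4(d+1)κ|Λ| - 2g'(d+1)|Λ| - |Λ| log 4/β`, i.e.
`E₁ ≥ ½ - {U+2g(d+1)}₊/(2g(d+1)) - 4κ/g - 2g'/g - log 4/(βg(d+1))`.
[cite: Koma2022, (6.36), App. B (B.11), (B.18), §8] -/
theorem nearestNeighbour_ge_coulomb (hL : Even L) (h4 : 4 ≤ L) {β : ℝ} (hβ : 0 < β) {κ : ℝ} (hκ : 0 ≤ κ) (U : ℝ)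
    {g : ℝ} (hg : 0 ≤ g) {g' : ℝ} (hg' : 0 ≤ g') :
    g * (d + 1) * (L : ℝ) ^ (d + 1) / 2 - max (U + 2 * g * (d + 1)) 0 * (L : ℝ) ^ (d + 1) / 2 -
        4 * (d + 1) * κ * (L : ℝ) ^ (d + 1) - 2 * g' * (d + 1) * (L : ℝ) ^ (d + 1) -
        (L : ℝ) ^ (d + 1) * Real.log 4 / β ≤
      g * ∑ i : Fin (d + 1), ∑ x : FermionTorus (d + 1) L,
        pairCorr β (hamiltonianC κ U g g' (fun (_ _ : FermionTorus (d + 1) L) => (0 : ℝ)) 0) x (shift x i) := by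
  have h3 : 3 ≤ L := by omega
  have h1 := nearestNeighbour_lower_bound_coulomb (d := d) h3 hβ hκ U g hg'
  have h2 := groundEnergy_hamiltonianC_le (d := d) h3 κ U g hg' (fun (_ _ : FermionTorus (d + 1) L) => (0 : ℝ)) 0
  have h2' := groundEnergy_hamiltonian_le (d := d) hL h4 κ U hg
  have hLpos : (0 : ℝ) ≤ (L : ℝ) ^ (d + 1) := by positivity
  -- `x + {-x}₊ = {x}₊` bookkeeping with `x = U/2 + g(d+1)`
  have hmax : max (U + 2 * g * (d + 1)) 0 / 2 = (U / 2 + g * (d + 1)) + max (-(U / 2 + g * (d + 1))) 0 := by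
    rcases le_or_gt 0 (U / 2 + g * (d + 1)) with h | h
    · rw [max_eq_left (by linarith), max_eq_right (by linarith)]; ring
    · rw [max_eq_right (by linarith), max_eq_left (by linarith)]; ring
  have : max (U + 2 * g * (d + 1)) 0 * (L : ℝ) ^ (d + 1) / 2 =
      ((U / 2 + g * (d + 1)) + max (-(U / 2 + g * (d + 1))) 0) * (L : ℝ) ^ (d + 1) := by
    rw [← hmax]; ring
  rw [this]
  nlinarith

end KomaPiFlux

end Literature.MathematicalPhysics.QuantumLattice

end
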